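import Summits.BirchSwinnertonDyer.BirchSwinnertonDyer.Theorems.PrintX9HowardContainmentPinnedOfSixLeaves
import Literature.NumberTheory.EllipticCurves.RingClassFieldTower
import Literature.NumberTheory.EllipticCurves.IwasawaAlgebraEisensteinTorsionExactProofs
import Literature.NumberTheory.EllipticCurves.HeegnerGeomCoherentDataOfFrameProofs
import Literature.NumberTheory.GaloisCohomology.Howard2004.DVRKolyvaginBoundPrintIntended
import HarnessLib

/-!
# T-161′-X9 — row 9's A-side and display re-derived against the PRINT-AS-INTENDED Howard leaf F-161′
# (`Howard2004.thm161_dvrKolyvaginBound_printIntended`): `howardContainmentLightFramePinned_of_howardIntended_kolyvaginSystem_cgs`,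
# `bsdpOnClassX9_of_sixLeaves_intended`

Cell `pub/bsd-print-x9`, seat `bsd-line-x9-p1` LEAD g10; pen plan g15 TURNKEY T-161′-X9 (2026-08-29T08:35:01Z: «`howardContainmentLightFramePinned_of_howard_kolyvaginSystem_cgs`
(p695713) re-proved with `(hH' : thm161_dvrKolyvaginBound_printIntended)` discharging (hp0) from the consumer's coefficient ring and (hu) from the
frame»); referee REF-167 «HD-STANDING» / REF-169 «HP0-STANDING» / REF-169a; lit g45 mint of F-161′. `--supports` stmt-BirchSwinnertonDyer-22642
(`stub_h161` = F-161). THEOREMS ONLY (no definition, no named fact, no instance, no `sorry`).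

WHY. The row-9 display `PrintX9OfKolyvaginSystemLeaf.bsdpOnClassX9_of_sixLeaves` (x9-p1 LEAD g7, p695713) takes the leaf F-161 =
`Howard2004.thm161_dvrKolyvaginBound` (Howard 2004 Thm. 1.6.1 print-as-WORDED: every DVR coefficient ring, every imaginary quadratic `K`).
The cell's G87 ENGINE road proves Thm. 1.6.1 only print-as-INTENDED — under `((p : ℕ) : R) ≠ 0` (mixed characteristic; PRINT GAP «@eqchar»)
and `¬ p ∣ Nat.card (𝓞 K)ˣ` (PRINT GAP «@(3,−3)-units») — which is the restated leaf F-161′. The chain below F-161 APPLIES it exactly once,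
inside the any-class-number cyclic port `HeegnerMuPartKSAnyClassNumber.portCyclic_anyClassNumber_of_controlGlue` (bsd-line-x10b-p1 LEAD g11,
p691788), as `h161 p K R N Rk Nbar Nq S κ hy hlarge hone` with `R = Λ/(X^m + p)` (the Eisenstein DVR of `W.eisensteinDVRSetting`) and `K` the
field of a `Thm413Hypotheses` frame (`p` odd, `d_K` odd, `d_K ≠ −3`). There both guards are FREE: (hp0) =
`IwasawaAlgebra.natCast_quotient_X_pow_add_C_ne_zero p hm`; (hu) = `card_units_eq_two_of_discr_lt` ∘
`IsImaginaryQuadratic.discr_lt_neg_four_of_odd` (`d_K < −4 ⇒ #𝓞_K^× = 2`, `p ≠ 2`). Everything else is re-plumbed VERBATIM.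

* `portCyclic_anyClassNumber_intended (hH' h411)` — p691788 §1 with `h161 ↦ hH'`, the control glue fed in CLOSED form
  (`HeegnerMuPartControlGlue.controlGlueKS_anyClassNumber`, x10b-p1-w8 g9) and the Kummer = strict letter by `kummerStrictOnFrames_holds`.
* `exists_coherentPair_isTorsion_muIneq_of_howardIntended_kolyvaginSystem_anyClassNumber (hH' h411)` — p691788 §2 twin (the
  coherent-pair μ-letter with torsion DERIVED from rank one, ANY class number).
* **`howardContainmentLightFramePinned_of_howardIntended_kolyvaginSystem_cgs :
  thm161_dvrKolyvaginBound_printIntended → CGLSHeegnerKolyvaginSystem → CGSHowardDivisibilityPLocalized → HowardContainmentLightFramePinned`**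
  (item 26356's decl from F-161′, F-411, CGS 6.5.2) — p695713 twin.
* **`bsdpOnClassX9_of_sixLeaves_intended (hH' hK hCGS hPT hHP hCP hT hμ) : Rank1Residual.BSDpOnClassX9`** — the row-9 display with F-161′
  for F-161 (six cite-only leaves {F-161′, F-411, CGS 6.5.2, `PinnedTransferPrintFacts`, `HeegnerPrintFactsX9`, `CyclotomicPrintFactsX9`} +
  the two K6 μ-inputs).
* `howardContainmentLightFramePinnedOfPrintSharp_of_howardIntended_kolyvaginSystem` — the deciding-crux decl 27077 shape from F-161′ + F-411
  (its `hMZ`, `hNV`, `hTw♯` idle), for the pen's glue.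
* F-161 ⟹ F-161′ (`thm161_dvrKolyvaginBound_printIntended_of_thm161`), so p695713's theorems are instances of these (not restated here).
HONEST FRAMING: CONDITIONAL on the leaves named; no item is closed by this file; no route verb is implied (re-pointing `hH` is the
pen's D-0059 consolidation round). When the ENGINE lands F-161′ as a kernel theorem, `bsdpOnClassX9_of_sixLeaves_intended (engine…)` is the
row-9 display over FIVE listed leaves + the engine's own cite-only inputs. «beyond-print theorem»: no. No summit statement is proved;
thm161 is NOT proved; BSD is NOT proved by any of this.

References: [Howard2004HeegnerKolyvagin] Thm. 1.6.1 (arXiv Thm. 2.6.1), p. 3 L23–25, p. 4 L47–51, §2.2 p. 6 L84–92, proof of Thm. 2.2.10,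
Thm. B; [CastellaGrossiLeeSkinner2022] Thm. 4.1.1, Rem. 4.1.4, §3.2; [CastellaGrossiSkinner2025] Thm. 6.5.2; [GrossLMS1991] §1;
[PerrinRiou1987BSMF] §3.4 Prop. 10.
-/

set_option linter.dupNamespace false
set_option autoImplicit false

noncomputable section

open scoped Classical Pointwise ContRepresentation TensorProduct NumberField

open Function NumberField IsDedekindDomain Field
open Literature Literature.NumberTheory.EllipticCurves WeierstrassCurve
open Literature.NumberTheory.EllipticCurves.ModularForms
open Literature.NumberTheory.EllipticCurves.CastellaGrossiLeeSkinner2022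
open Literature.NumberTheory.GaloisCohomology Literature.NumberTheory.GaloisCohomology.Howard2004
open Literature.NumberTheory.Automorphic
open Literature.NumberTheory.GaloisRepresentations Literature.NumberTheory.GaloisRepresentations.DiscreteGaloisModule
open Summit.BirchSwinnertonDyer.BirchSwinnertonDyer.Theses.PrintX9
open Summit.BirchSwinnertonDyer.BirchSwinnertonDyer.Theorems
open Summit.BirchSwinnertonDyer.BirchSwinnertonDyer.Theorems.HeegnerMuPartControlGlue (Stmt.kummerStrictOnFrames)
open Summit.BirchSwinnertonDyer.BirchSwinnertonDyer.Theorems.HeegnerStabilizedOfKSLeaf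
  (torsionFree_and_isTorsion_quotient_of_kolyvaginSystemLeaf)

namespace Summit.BirchSwinnertonDyer.BirchSwinnertonDyer.Theorems.PrintX9OfKolyvaginSystemLeafIntended

/-! ## §1 The any-class-number cyclic port from F-161′ (control glue in closed form) -/

set_option synthInstance.maxHeartbeats 80000 in
/-- **The cyclic port (`HasSpecWitnesses` at every Eisenstein prime `𝔮_m`, `m ≫ 0`) from F-161′ (`hH'`) and CGLS Thm. 4.1.1 (`h411`),
for ANY class number** — `HeegnerMuPartKSAnyClassNumber.portCyclic_anyClassNumber_of_controlGlue` VERBATIM with `h161 ↦ hH'`, the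
Kummer = strict letter := `kummerStrictOnFrames_holds`, the control glue := `controlGlueKS_anyClassNumber` (closed forms), and Howard's
conclusion invoked with the two guards `(p : Λ/(X^m+p)) ≠ 0`, `p ∤ #𝓞_K^×` read off the ring and the frame.
[cite: Howard2004HeegnerKolyvagin, Thm. 1.6.1 and Thm. 2.2.10 (proof)] [cite: CastellaGrossiLeeSkinner2022, Thm. 4.1.1 and Rem. 4.1.4] -/
theorem portCyclic_anyClassNumber_intended (hH' : thm161_dvrKolyvaginBound_printIntended)
    (h411 : Literature.NumberTheory.EllipticCurves.CastellaGrossiLeeSkinner2022.thm411_exists_kolyvaginSystem_one_ne_zero) :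
    ∀ (N : ℕ) [NeZero N] (W : WeierstrassCurve ℚ) [W.IsGloballyMinimal] (K : Type) [Field K] [NumberField K]
      (p : ℕ) [Fact p.Prime] (κ : ZpExtension K p) (γ : Field.absoluteGaloisGroup K)
      (jbar : AlgebraicClosure K →+* ℂ),
      CastellaGrossiLeeSkinner2022.Thm413Hypotheses N W K p κ γ →
      W.HasIrreducibleModPGaloisRep p → (W.baseChange K).HasIrreducibleModPGaloisRep p →
      SatisfiesHeegnerHypothesis p K →
      ∀ (D : (W.baseChange K).LambdaAdicSelmerData κ γ)
        (C : CastellaGrossiLeeSkinner2022.StabilizedHeegnerData N W K κ jbar)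
        (X : (W.baseChange K).SelmerDualData κ γ) (z : D.S),
      (∀ (k : ℕ) (hk : C.depth < k), D.proj k z ∈ CastellaGrossiLeeSkinner2022.stabilizedClassLayer C k hk) →
      CastellaGrossiLeeSkinner2022.stabilizedHeegnerModule D C = Submodule.span (IwasawaAlgebra p) {z} →
      Module.Finite (IwasawaAlgebra p) D.S → Module.Finite (IwasawaAlgebra p) X.X →
      Module.IsTorsion (IwasawaAlgebra p) (D.S ⧸ CastellaGrossiLeeSkinner2022.stabilizedHeegnerModule D C) →
      HeegnerMuPartStabilized.HasSpecWitnesses p D.S X.X (CastellaGrossiLeeSkinner2022.stabilizedHeegnerModule D C) := by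
  intro N _ W _ K _ _ p _ κ γ jbar hyp hirr hirrK hHp D C X z hz hcyc hfinS hfinX htor
  -- guard (hu) of F-161′ from the frame: `d_K` odd, `≠ −3` ⇒ `d_K < −4` ⇒ `#𝓞_K^× = 2`, and `p ≠ 2`
  have hu : ¬ p ∣ Nat.card (𝓞 K)ˣ := by
    rw [card_units_eq_two_of_discr_lt hyp.isImaginaryQuadratic
      (hyp.isImaginaryQuadratic.discr_lt_neg_four_of_odd hyp.discr_odd hyp.discr_ne)]
    exact fun h ↦ hyp.p_ne_two ((Nat.prime_dvd_prime_iff_eq Fact.out Nat.prime_two).mp h)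
  obtain ⟨m₀, hA⟩ := HeegnerMuPartKSAnyClassNumber.howardInputsCore_anyClassNumber h411 N W K p κ γ jbar hyp hirr hirrK
    hHp D C X z hz hcyc hfinS hfinX htor
  -- `z ≠ 0` from STUB A at the level `max m₀ 1`: the Kolyvagin system's bottom class is `ctrlLevel … z`, non-zero
  have hz0 : z ≠ 0 := by
    have hm' : 1 ≤ max m₀ 1 := le_max_right _ _
    haveI := hyp.isElliptic
    letI := IwasawaAlgebra.isDomain_quotient_X_pow_add_C p hm'
    letI := IwasawaAlgebra.isDiscreteValuationRing_quotient_X_pow_add_C p hm'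
    haveI := IwasawaAlgebra.EisensteinCoeff.isLocalRing_succ p hm'
    letI := IwasawaAlgebra.EisensteinCoeff.algebraOfSpecSucc p (max m₀ 1)
    haveI := W.isScalarTower_algebraOfSpecSucc (K := K) (p := p) (m := max m₀ 1)
    letI := W.residueModuleSucc (K := K) (p := p) hm'
    obtain ⟨_S₀, _hpS₀, _hbad₀, _hSN₀, _hSσ₀, _L₀, _hL₀, _hLS₀, _jbar₀, _cd₀, _Dd₀, _fs₀, _t₀, _ht₀, _I₀, _hy₀, κ₀, _hlarge₀,
      hone₀, hlink₀⟩ := hA (max m₀ 1) hm' (le_max_left _ _)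
    intro hz
    subst hz
    exact hone₀ (funext fun k ↦ by
      rw [hlink₀ k, Pi.zero_apply, map_zero, map_zero]
      rfl)
  obtain ⟨c, m₁, hB⟩ :=
    HeegnerMuPartControlGlue.controlGlueKS_anyClassNumber HeegnerMuPartControlGlue.kummerStrictOnFrames_holds N W K p κ γ
      jbar hyp hirr hirrK hHp D C X z hz hcyc hfinS hfinX htor hz0
  refine ⟨c, max (max m₀ m₁) 1, fun m hm' ↦ ?_⟩
  have hm : 1 ≤ m := le_trans (le_max_right _ _) hm'
  have hm0 : m₀ ≤ m := le_trans ((le_max_left _ _).trans (le_max_left _ _)) hm'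
  have hm1 : m₁ ≤ m := le_trans ((le_max_right _ _).trans (le_max_left _ _)) hm'
  haveI := hyp.isElliptic
  letI := IwasawaAlgebra.isDomain_quotient_X_pow_add_C p hm
  letI := IwasawaAlgebra.isDiscreteValuationRing_quotient_X_pow_add_C p hm
  haveI := IwasawaAlgebra.EisensteinCoeff.isLocalRing_succ p hm
  letI := IwasawaAlgebra.EisensteinCoeff.algebraOfSpecSucc p m
  haveI := W.isScalarTower_algebraOfSpecSucc (K := K) (p := p) (m := m)
  letI := W.residueModuleSucc (K := K) (p := p) hm
  obtain ⟨S, hpS, hbad, hSN, hSσ, L, hL, hLS, jbar', cd, Dd, fs, t, ht, I, hy, κKS, hlarge, hone, hlink⟩ := hA m hm hm0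
  have hconc := hH' p K _ _ _ _ _ (W.eisensteinDVRSetting (κ.unitTwist (-1)) hm S hpS hbad L hL hLS jbar' cd Dd fs)
    κKS hy (IwasawaAlgebra.natCast_quotient_X_pow_add_C_ne_zero p hm) hu hlarge hone
  have hone_eq : κKS.one =
      fun k ↦ I.proj (k + 1) (D.toEisensteinH1Linear hm t ht I hyp.topGenerator hyp.noPTorsion z) :=
    funext hlink
  rw [hone_eq] at hconc
  exact hB m hm hm1 S hpS hbad hSN hSσ L hL hLS jbar' cd Dd fs t ht I hy hconc

/-! ## §2 The coherent-pair μ-letter with torsion, any class number, from F-161′ + F-411 -/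

/-- **The coherent-pair μ-letter L∃ with its torsion clause, from F-161′ and F-411, for ANY CLASS NUMBER** — p691788 §2
(`…_of_howard_kolyvaginSystem_anyClassNumber_of_controlGlue`) VERBATIM with the cyclic port §1 (control glue closed): the engine
`exists_coherent_pair_envelope_class`, the torsion clause `torsionFree_and_isTorsion_quotient_of_kolyvaginSystemLeaf` (F-411 + rank one), then
`HeegnerMuPartStabilized.lengthAt_torsion_le_two_mul_of_hasSpecWitnesses`. CONDITIONAL on F-161′ and F-411.
[cite: Howard2004HeegnerKolyvagin, Thm. 1.6.1 and proof of Thm. 2.2.10] [cite: CastellaGrossiLeeSkinner2022, Thm. 4.1.1 and Rem. 4.1.4]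
[cite: PerrinRiou1987BSMF, §3.4 Prop. 10] -/
theorem exists_coherentPair_isTorsion_muIneq_of_howardIntended_kolyvaginSystem_anyClassNumber
    (hH' : thm161_dvrKolyvaginBound_printIntended) (hKS : thm411_exists_kolyvaginSystem_one_ne_zero) :
    ∀ (N : ℕ) [NeZero N] (W : WeierstrassCurve ℚ) [W.IsGloballyMinimal] (K : Type) [Field K] [NumberField K]
      (p : ℕ) [Fact p.Prime] (κ : ZpExtension K p) (γ : Field.absoluteGaloisGroup K)
      (jbar : AlgebraicClosure K →+* ℂ),
      Thm413Hypotheses N W K p κ γ →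
      W.HasIrreducibleModPGaloisRep p → (W.baseChange K).HasIrreducibleModPGaloisRep p →
      SatisfiesHeegnerHypothesis p K →
      ¬ p ∣ N →
      (∀ k, ringClassSubgroup K (p ^ (k + 1)) jbar ≤ κ.layerSubgroup k) →
      Nat.card (ringClassGalOver (jbar.comp (algebraMap K (AlgebraicClosure K))) p 1) = p - 1 →
      ∀ (Dt : ModularParametrizationData W N) (β : ℤ), (4 * N : ℤ) ∣ β ^ 2 - NumberField.discr K →
      ∀ (D : (W.baseChange K).LambdaAdicSelmerData κ γ) (X : (W.baseChange K).SelmerDualData κ γ),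
      ∃ (C : StabilizedHeegnerData N W K κ jbar) (F : HeegnerFamily N W K κ jbar),
        C.Dt = Dt ∧ F.Dt = Dt ∧ C.β = β ∧ F.β = β ∧
        heegnerModule D F ≤ stabilizedHeegnerModule D C ∧
        (∃ g : IwasawaAlgebra p, g ≠ 0 ∧ g • stabilizedHeegnerModule D C ≤ heegnerModule D F) ∧
        (Module.Finite (IwasawaAlgebra p) D.S → Module.finrank (IwasawaAlgebra p) D.S = 1 →
          NoZeroSMulDivisors (IwasawaAlgebra p) D.S ∧
            Module.IsTorsion (IwasawaAlgebra p) (D.S ⧸ stabilizedHeegnerModule D C)) ∧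
        (Module.Finite (IwasawaAlgebra p) D.S → Module.Finite (IwasawaAlgebra p) X.X →
          Module.finrank (IwasawaAlgebra p) D.S = 1 →
          ∀ 𝔭 : PrimeSpectrum (IwasawaAlgebra p), 𝔭.asIdeal = Ideal.span {(p : IwasawaAlgebra p)} →
            Module.lengthAt (IwasawaAlgebra p) (Submodule.torsion (IwasawaAlgebra p) X.X) 𝔭 ≤
              2 * Module.lengthAt (IwasawaAlgebra p) (D.S ⧸ stabilizedHeegnerModule D C) 𝔭) := by
  intro N _ W _ K _ _ p _ κ γ jbar hyp hirr hirrK hHp hpN hTw1 hcardp Dt β hβ D X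
  have hlev : N = W.conductorNorm ℤ := hyp.level
  subst hlev
  haveI : W.IsElliptic := hyp.isElliptic
  -- the engine's coherent pair `(C, F)` on `(Dt, β)` WITH its class `z = κ_∞`
  obtain ⟨C, F, hCDt, hFDt, hCβ, hFβ, hfwd, hrev, z, hz, hcyc⟩ :=
    exists_coherent_pair_envelope_class (W := W) hyp.isImaginaryQuadratic hyp.heegner Dt hβ jbar hyp.ordinary hpN κ
      hyp.topGenerator hTw1 hcardp hyp.noPTorsion D
  refine ⟨C, F, hCDt, hFDt, hCβ, hFβ, hfwd, hrev, fun hfinS hS1 ↦ ?_, fun hfinS hfinX hS1 𝔭 h𝔭 ↦ ?_⟩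
  · haveI := hfinS
    exact torsionFree_and_isTorsion_quotient_of_kolyvaginSystemLeaf hKS hyp jbar D C hz hcyc hS1
  · haveI := hfinS
    haveI := hfinX
    obtain ⟨-, htorC⟩ := torsionFree_and_isTorsion_quotient_of_kolyvaginSystemLeaf hKS hyp jbar D C hz hcyc hS1
    -- the specialised witnesses at `(D, C, X, κ_∞)` from the F-161′ cyclic port §1
    have hW := portCyclic_anyClassNumber_intended hH' hKS
      (W.conductorNorm ℤ) W K p κ γ jbar hyp hirr hirrK hHp D C X z hz hcyc hfinS hfinX htorC
    exact HeegnerMuPartStabilized.lengthAt_torsion_le_two_mul_of_hasSpecWitnesses p _ htorC hW 𝔭 h𝔭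

/-! ## §3 Row 9: the A-side (item 26356's decl) and the display from F-161′ -/

/-- **`HowardContainmentLightFramePinned` (stmt-BirchSwinnertonDyer-26356) from F-161′, F-411 and CGS 6.5.2 on EVERY rank-one light X9
frame** — `PrintX9OfKolyvaginSystemLeaf.howardContainmentLightFramePinned_of_howard_kolyvaginSystem_cgs` (p695713) VERBATIM with the
any-class-number μ-letter §2 (F-161′) for p691788 §2 (F-161): the engine's coherent pair WITH CLASS on `(Dt, H.β)`, `κ_∞ ≠ 0` from F-411,
torsion and the μ-inequality from `Λ`-rank one (`hCGS`), the forward envelope, the CGS 6.5.2 p-localized containment and the promotion.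
CONDITIONAL on the three leaves. [cite: Howard2004HeegnerKolyvagin, Thm. 1.6.1, proof of Thm. 2.2.10, Thm. B]
[cite: CastellaGrossiLeeSkinner2022, Thm. 4.1.1, Rem. 4.1.4] [cite: CastellaGrossiSkinner2025, Thm. 6.5.2] -/
theorem howardContainmentLightFramePinned_of_howardIntended_kolyvaginSystem_cgs (hH' : thm161_dvrKolyvaginBound_printIntended) :
    CGLSHeegnerKolyvaginSystem → CGSHowardDivisibilityPLocalized → HowardContainmentLightFramePinned := by
  intro hKS hCGS W _ _ p _ _ K _ _ hX9 hK hodd h3 hHN hHp hirr κ hκ γ hγ Dt H ιC _hc _hrk _hfin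
  letI : Algebra K ℂ := ιC.toAlgebra
  let jbar : AlgebraicClosure K →+* ℂ :=
    (IsAlgClosed.lift (R := K) (M := ℂ) (S := AlgebraicClosure K)).toRingHom
  obtain ⟨D⟩ := LambdaAdicSelmerDataExists.nonempty_lambdaAdicSelmerData (W.baseChange K) p κ hγ
  obtain ⟨X⟩ := (W.baseChange K).nonempty_selmerDualData_holds κ γ hγ
  have hp : p.Prime := Fact.out
  have hX9' := Summit.BirchSwinnertonDyer.BirchSwinnertonDyer.Rank1Residual.classX9_census_of_classX9 W p hX9
  have hp_odd : Odd p := hp.odd_of_ne_two hX9'.ne_two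
  have hyp := Summit.BirchSwinnertonDyer.Rank1Residual.X9.thm413Hypotheses_of_lightFrame hX9' hK hodd h3 hHN hHp hκ hγ
  -- the any-class-number μ-letter at `(Dt, H.β, D, X)` from F-161′ and F-411
  have hKS' : thm411_exists_kolyvaginSystem_one_ne_zero := hKS
  obtain ⟨C, F, -, hFDt, -, -, hfwd, ⟨g, hg, hrev⟩, htor_of, hμ_of⟩ :=
    exists_coherentPair_isTorsion_muIneq_of_howardIntended_kolyvaginSystem_anyClassNumber hH' hKS'
      (W.conductorNorm ℤ) W K p κ γ jbar hyp hX9'.irr hirr hHp hX9'.not_dvd_conductorNorm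
      (fun k ↦ Literature.NumberTheory.EllipticCurves.anticyclotomicTowerSharp K p hp_odd hK κ hκ jbar k)
      (card_ringClassGalOver_prime_one_of_frame hK hodd h3 hp hHp jbar) Dt H.β H.dvd_sq_sub D X
  -- CGS Thm. 6.5.2 BY NAME at `(D, C, X)`: finiteness and `Λ`-rank one
  have h652 : CastellaGrossiSkinner2025.thm652_stabilized_rankOne_charIdeal_torsion_dvd_pLocalized.{0} := hCGS
  obtain ⟨⟨hfinS, hS1⟩, hfinX, -, -⟩ := h652 (W.conductorNorm ℤ) W K p κ γ jbar hyp D C X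
  haveI := hfinS
  haveI := hfinX
  haveI : IsNoetherian (IwasawaAlgebra p) X.X := isNoetherian_of_isNoetherianRing_of_finite _ _
  haveI : Module.Finite (IwasawaAlgebra p) (Submodule.torsion (IwasawaAlgebra p) X.X) := inferInstance
  haveI : Module.Finite (IwasawaAlgebra p) (D.S ⧸ stabilizedHeegnerModule D C) := inferInstance
  -- torsion of `𝔖 ⧸ Λκ_∞(C)` (from `κ_∞ ≠ 0` and rank one) and the μ-inequality at `(p)`
  obtain ⟨-, htorC⟩ := htor_of hfinS hS1
  have hμ := hμ_of hfinS hfinX hS1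
  have htorF : Module.IsTorsion (IwasawaAlgebra p) (D.S ⧸ heegnerModule D F) :=
    isTorsion_quotient_heegnerModule_of_smul_stabilizedHeegnerModule_le D F C hg hrev htorC
  -- `I(ℋ_F) ⊆ I(Λκ_C)` (forward envelope)
  have henv : heegnerCharIdeal D F ≤ stabilizedHeegnerCharIdeal D C :=
    heegnerCharIdeal_le_stabilizedHeegnerCharIdeal_of_le D F C htorF hfwd
  -- `(p^m) · I(Λκ_C)² ⊆ char(𝒳_tors)` (CGS 6.5.2 p-localized)
  obtain ⟨m, hm⟩ := CastellaGrossiSkinner2025.span_pow_mul_sq_le_charIdeal_torsion_of_thm652_stabilized h652 hyp D C X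
  have hC2 : stabilizedHeegnerCharIdeal D C ^ 2 ≤
      Module.charIdeal (IwasawaAlgebra p) (Submodule.torsion (IwasawaAlgebra p) X.X) := by
    rw [stabilizedHeegnerCharIdeal_def] at hm ⊢
    exact IwasawaAlgebra.sq_charIdeal_le_charIdeal_of_span_p_pow_mul_le_of_lengthAt_le_two_mul
      (Submodule.torsion_isTorsion (R := IwasawaAlgebra p) (M := X.X)) htorC hμ hm
  exact ⟨jbar, D, F, X, hFDt, (Ideal.pow_right_mono henv 2).trans hC2⟩

/-- **The deciding crux decl `HowardContainmentLightFramePinnedOfPrintSharp` (stmt-BirchSwinnertonDyer-27077: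
`hMZ → hNV → hCGS → hTw♯ → A^pin`) from F-161′ and F-411, its binders `hMZ`, `hNV`, `hTw♯` IDLE** — twin of p690035's
`howardContainmentLightFramePinnedOfPrintSharp_of_howard_kolyvaginSystem` for the pen's glue term. CONDITIONAL; no route verb implied.
[cite: Howard2004HeegnerKolyvagin, Thm. 1.6.1] [cite: CastellaGrossiLeeSkinner2022, Thm. 4.1.1, Rem. 4.1.4] [cite: CastellaGrossiSkinner2025, Thm. 6.5.2] -/
theorem howardContainmentLightFramePinnedOfPrintSharp_of_howardIntended_kolyvaginSystem (hH' : thm161_dvrKolyvaginBound_printIntended) :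
    CGLSHeegnerKolyvaginSystem → HowardContainmentLightFramePinnedOfPrintSharp :=
  fun hKS _hMZ _hNV hCGS _hTw ↦ howardContainmentLightFramePinned_of_howardIntended_kolyvaginSystem_cgs hH' hKS hCGS

/-- **DISPLAY — `BSD_p` on the X9 leaf from SIX cite-only print leaves with F-161′ in place of F-161**: Howard 2004 Thm. 1.6.1
print-as-intended (F-161′), CGLS 2022 Thm. 4.1.1 in Kolyvagin-system form (F-411), CGS 2025 Thm. 6.5.2, `PinnedTransferPrintFacts`,
`HeegnerPrintFactsX9`, `CyclotomicPrintFactsX9`, and `MuTransfer` / `AnalyticMuZeroX9` (items 19629 / 19630). The term of `PrintX9.closes`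
with the landed assembly (`TorsionLayerPinned.assemblyLightFramePinned_holds`), the landed T-G′ door (`PrintX9Pinned.twoSidedLinkPinnedOfPrint_holds`)
and the A-side above — p695713's `bsdpOnClassX9_of_sixLeaves` with `hH' : F-161′` for `hH : F-161`. CONDITIONAL on the eight hypotheses;
a display, not a closure. [cite: Howard2004HeegnerKolyvagin, Thm. 1.6.1, Thm. B] [cite: CastellaGrossiLeeSkinner2022, Thm. 4.1.1, Rem. 4.1.4]
[cite: CastellaGrossiSkinner2025, Thm. 6.5.2] -/
theorem bsdpOnClassX9_of_sixLeaves_intended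
    (hH' : thm161_dvrKolyvaginBound_printIntended) (hK : CGLSHeegnerKolyvaginSystem) (hCGS : CGSHowardDivisibilityPLocalized)
    (hPT : PinnedTransferPrintFacts) (hHP : HeegnerPrintFactsX9) (hCP : CyclotomicPrintFactsX9)
    (hT : MuTransfer) (hμ : AnalyticMuZeroX9) :
    Summit.BirchSwinnertonDyer.BirchSwinnertonDyer.Rank1Residual.BSDpOnClassX9 :=
  Summit.BirchSwinnertonDyer.BirchSwinnertonDyer.Rank1Residual.TorsionLayerPinned.assemblyLightFramePinned_holds
    (howardContainmentLightFramePinned_of_howardIntended_kolyvaginSystem_cgs hH' hK hCGS)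
    (Summit.BirchSwinnertonDyer.BirchSwinnertonDyer.Theorems.PrintX9Pinned.twoSidedLinkPinnedOfPrint_holds hPT hHP)
    hT hμ hHP hCP

end Summit.BirchSwinnertonDyer.BirchSwinnertonDyer.Theorems.PrintX9OfKolyvaginSystemLeafIntended

end
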